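import Literature.Geometry.Lorentzian.CoordConstraintAdjoint
import Literature.Geometry.Lorentzian.CoordConstraintBridge
import Literature.Geometry.Lorentzian.SchwarzschildCylinderSymmetries
import Literature.Geometry.Lorentzian.KerrCylinderParameterClosenessK
import HarnessLib

/-!
# The Schwarzschild cylinder data: vacuum in coordinates and the four tangential KIDs
# in the operator form of the Corvino–Schoen / Chruściel–Delay scheme

Support file (all results proved; no named facts, no definitions) for the named fact
`LiMei.interiorKerrGluing` (`InteriorKerrGluing.lean`; J. Li, H. Mei, *A construction of
collapsing spacetimes in vacuum*, Comm. Math. Phys. 378 (2020) = arXiv:2005.01249, Prop. 4.1).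
Step "S4 ⊇" of the printed proof (loc. cit. pp. 23–24: *"the kernel `Ker DΦ*_{(ḡ_{m₀},π̄_{m₀})}`
… is spanned by `(0, ∂_t), (0, Ω₁), (0, Ω₂), (0, Ω₃)`, the Killing fields of Schwarzschild, all
tangent to `{r = r₀}`"* — Moncrief 1975) in the OPERATOR language of the coordinate deformation
calculus (`CoordConstraintAdjoint.lean`: the symmetrised formal adjoint `DΦ* = (DH*, DM*ˢ)`,
rows `adjHamG`, `adjHamK`, `adjMomGS`, `adjMomKS`), for the coefficient fields of the exact
Schwarzschild-cylinder datum on `E3` (`kerrCylinderDatum` at spin `0`, `KerrCylinderDatum.lean`):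
`G₀ = cylH M 0 r₀ τ₀ R` and `K₀ = cylK M 0 _ τ₀ R` (equal to Li–Mei's (4.1) `ḡ_M`, `k̄_M` =
`gbarRep`, `kbarRep` on `{1 < ‖y‖}`).

* `hamAt_cylH_cylK_eq_zero`, `momFn_cylH_cylK_eq_zero` — **exact Kerr-cylinder data solve the
  vacuum constraints in coordinates** on `{1 < ‖y‖}` (all admissible `(m, a)`): the Gauss–Codazzi
  vacuum of `KerrCylinderDatum.lean` (`isVacuumOn_kerrCylinderDatum`) read through the adapter
  `LiMei.isVacuumOn_iff_coord` (`CoordConstraintBridge.lean`);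
* `cylH_zero_spin_apply`, `cylK_zero_spin_apply`, `isMetricOn_cylH_zero_spin` — the zero-spin
  fields are `gbarRep`, `kbarRep` on `{1 < ‖y‖}` and form a metric pair there;
* `lieFormAt_apply_eq_coordLie₂`, `coordLie₂_congr` — the coordinate Lie derivative of
  `CoordConstraintAdjoint.lean` (`lieFormAt`, on `CLM`-valued fields) is the one of
  `SchwarzschildCylinderSymmetries.lean` (`coordLie₂`, on scalar functions of `(y, v, w)`);
* `lieFormAt_cylH_zero_spin_dirVec`, `lieFormAt_cylK_zero_spin_dirVec`,
  `lieFormAt_cylH_zero_spin_skew`, `lieFormAt_cylK_zero_spin_skew` — `𝓛_X G₀ = 0 = 𝓛_X K₀` on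
  `{1 < ‖y‖}` for `X = y/‖y‖` (`∂_t`) and `X = A·`, `A` skew (`Ω_i`) (`coordLie₂_gbarRep_dirVec`
  etc. of `SchwarzschildCylinderSymmetries.lean`);
* **`kid_cylinder_dirVec`, `kid_cylinder_skew`** — the pairs `(N, X) = (0, y/‖y‖)` and
  `(0, A·)` satisfy the KID equations `DH*_γ N + DM*ˢ_γ X = 0`, `DH*_κ N + DM*ˢ_κ X = 0` at every
  point of `{1 < ‖y‖}` (`IsMetricOn.adjMomS_eq_zero_of_lie_eq_zero`: Killing + `𝓛_X K = 0` +
  `M(X) = 0`), and **`linMomFn_cylinder_dirVec_eq_divAt`, `linMomFn_cylinder_skew_eq_divAt`** —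
  consequently the pairing of `DΦ_{(G₀,K₀)}(γ, κ)` with each of them is an exact divergence
  (`linConstraint_pairing_eq_divAt_of_kid_sym`): the source of the `4`-dimensional cokernel
  absorbed by the Kerr parameters `(m, a⃗)` in Li–Mei's degree argument (p. 25).

(The converse inclusion "⊆" — no other KIDs — is not treated here.)

## References

* J. Li, H. Mei, Comm. Math. Phys. 378 (2020), arXiv:2005.01249, §4, pp. 23–25. [LiMei2020]
* V. Moncrief, *Spacetime symmetries and linearization stability of the Einstein equations. I*,
  J. Math. Phys. 16 (1975) 493–498, §III.
* P. T. Chruściel, E. Delay, Mém. SMF 94 (2003), §2. [ChruscielDelay2003]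
-/

noncomputable section

set_option maxSynthPendingDepth 3

open Set Filter ContinuousLinearMap Module Metric
open scoped Topology ContDiff RealInnerProductSpace

namespace Literature.Geometry.Lorentzian

namespace LiMei

open MetricCoord

/-! ### The coordinate Lie derivatives `lieFormAt` and `coordLie₂` agree -/

/-- `lieFormAt β X x (v, w) = coordLie₂ (β · · ·) X x v w` for a field of bilinear forms `β`
differentiable at `x` (evaluation commutes with the derivative, `OpensChart.fderiv_apply₂`).
[folklore] -/
theorem lieFormAt_apply_eq_coordLie₂ {β : E3 → E3 →L[ℝ] E3 →L[ℝ] ℝ} {X : E3 → E3} {x : E3}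
    (hβ : DifferentiableAt ℝ β x) (v w : E3) :
    lieFormAt β X x v w = coordLie₂ (fun z v w ↦ β z v w) X x v w := by
  rw [lieFormAt_apply, coordLie₂, OpensChart.fderiv_apply₂ β hβ v w (X x)]

/-- `coordLie₂` at `x` only depends on the germ of the tensor at `x`. [folklore] -/
theorem coordLie₂_congr {T₁ T₂ : E3 → E3 → E3 → ℝ} {X : E3 → E3} {x : E3} (v w : E3)
    (h : ∀ᶠ z in 𝓝 x, ∀ v w, T₁ z v w = T₂ z v w) :
    coordLie₂ T₁ X x v w = coordLie₂ T₂ X x v w := by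
  have hvw : (fun z ↦ T₁ z v w) =ᶠ[𝓝 x] fun z ↦ T₂ z v w := h.mono fun z hz ↦ hz v w
  have hx : ∀ v w, T₁ x v w = T₂ x v w := h.self_of_nhds
  rw [coordLie₂, coordLie₂, hvw.fderiv_eq, hx, hx]

/-! ### Exact Kerr-cylinder data are vacuum in coordinates -/

section Vacuum

variable [Kerr.Facts] {m a r₀ : ℝ}

/-- **The Hamiltonian constraint of the exact Kerr-cylinder fields vanishes** on `{1 < ‖y‖}`:
`hamAt (cylH m a r₀ τ₀ R) (cylK m a _ τ₀ R) y = 0` for admissible `(m, a)` (Gauss equation for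
the cylinder `{r = r₀}` in the Ricci-flat Kerr chart, `isVacuumOn_kerrCylinderDatum`, read in
coordinates by `LiMei.isVacuumOn_iff_coord`). [cite: LiMei2020, §4, p. 22] -/
theorem hamAt_cylH_cylK_eq_zero (ha : |a| < m) (h₁ : Kerr.rMinus m a < r₀) (h₂ : r₀ < Kerr.rPlus m a)
    (τ₀ : ℝ) (R : E3 →ₗᵢ[ℝ] E3) {y : E3} (hy : 1 < ‖y‖) :
    hamAt (cylH m a r₀ τ₀ R) (cylK m a (pos_of_rMinus_lt ha h₁) τ₀ R) y = 0 :=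
  (((isVacuumOn_iff_coord (EuclideanSpace.basisFun (Fin 3) ℝ).toBasis {y : E3 | 1 < ‖y‖}
    (kerrCylinderDatum ha h₁ h₂ τ₀ R)).1 (isVacuumOn_kerrCylinderDatum ha h₁ h₂ τ₀ R)) y hy).1

/-- **The momentum constraint of the exact Kerr-cylinder fields vanishes** on `{1 < ‖y‖}`, in any
basis `b`: `momFn b (cylH m a r₀ τ₀ R) (cylK m a _ τ₀ R) y v = 0` (Codazzi equation,
`isVacuumOn_kerrCylinderDatum`, through `LiMei.isVacuumOn_iff_coord`). [cite: LiMei2020, §4, p. 22] -/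
theorem momFn_cylH_cylK_eq_zero {ι : Type*} [Fintype ι] (b : Basis ι ℝ E3) (ha : |a| < m)
    (h₁ : Kerr.rMinus m a < r₀) (h₂ : r₀ < Kerr.rPlus m a) (τ₀ : ℝ) (R : E3 →ₗᵢ[ℝ] E3) {y : E3}
    (hy : 1 < ‖y‖) (v : E3) :
    momFn b (cylH m a r₀ τ₀ R) (cylK m a (pos_of_rMinus_lt ha h₁) τ₀ R) y v = 0 :=
  (((isVacuumOn_iff_coord b {y : E3 | 1 < ‖y‖} (kerrCylinderDatum ha h₁ h₂ τ₀ R)).1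
    (isVacuumOn_kerrCylinderDatum ha h₁ h₂ τ₀ R)) y hy).2 v

/-- The metric components of the exact Kerr-cylinder datum form a smooth symmetric nondegenerate
field on all of `E3`. [folklore] -/
theorem isMetricOn_cylH (ha : |a| < m) (h₁ : Kerr.rMinus m a < r₀) (h₂ : r₀ < Kerr.rPlus m a)
    (τ₀ : ℝ) (R : E3 →ₗᵢ[ℝ] E3) : IsMetricOn (cylH m a r₀ τ₀ R) (univ : Set E3) :=
  (kerrCylinderDatum ha h₁ h₂ τ₀ R).isMetricOn_coordH

/-- The second-fundamental-form components of the exact Kerr-cylinder datum are smooth on `E3`.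
[folklore] -/
theorem contDiff_cylK (ha : |a| < m) (h₁ : Kerr.rMinus m a < r₀) (h₂ : r₀ < Kerr.rPlus m a)
    (τ₀ : ℝ) (R : E3 →ₗᵢ[ℝ] E3) : ContDiff ℝ ∞ (cylK m a (pos_of_rMinus_lt ha h₁) τ₀ R) :=
  (kerrCylinderDatum ha h₁ h₂ τ₀ R).contDiff_coordK

end Vacuum

/-! ### The zero-spin fields on `{1 < ‖y‖}` -/

section ZeroSpin

variable [Kerr.Facts] {M r₀ : ℝ}

omit [Kerr.Facts] in
/-- Admissibility of the Schwarzschild parameters `(M, 0)` for `0 < r₀ < 2M`. [folklore] -/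
theorem admissible_zero_spin (hr₀ : 0 < r₀) (h2M : r₀ < 2 * M) :
    |(0 : ℝ)| < M ∧ Kerr.rMinus M 0 < r₀ ∧ r₀ < Kerr.rPlus M 0 := by
  obtain ⟨δ, hδ, hbox⟩ := kerrBox hr₀ h2M
  exact hbox M 0 (by rw [sub_self, abs_zero, add_zero]; exact hδ.le)

omit [Kerr.Facts] in
/-- On `{1 ≤ ‖y‖}` the zero-spin metric field is Li–Mei's `ḡ_M` (4.1): `cylH M 0 r₀ τ₀ R y = gbarRep M r₀ y`.
[cite: LiMei2020, (4.1)] -/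
theorem cylH_zero_spin_apply (hr₀ : 0 < r₀) (τ₀ : ℝ) (R : E3 →ₗᵢ[ℝ] E3) {y : E3} (hy : 1 ≤ ‖y‖)
    (v w : E3) : cylH M 0 r₀ τ₀ R y v w = gbarRep M r₀ y v w := by
  have hy0 : y ≠ 0 := by
    rintro rfl; rw [norm_zero] at hy; exact absurd hy (by norm_num)
  rw [cylH_apply, cylCutoff_of_le_norm hy, cylH₀_zero_spin M hr₀ τ₀ R hy0]
  ring

/-- On `{1 < ‖y‖}` the zero-spin second fundamental form is Li–Mei's `k̄_M` (4.1):
`cylK M 0 _ τ₀ R y = kbarRep M r₀ y`. [cite: LiMei2020, (4.1)] -/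
theorem cylK_zero_spin_apply (hr₀ : 0 < r₀) (h2M : r₀ < 2 * M) (τ₀ : ℝ) (R : E3 →ₗᵢ[ℝ] E3)
    {y : E3} (hy : 1 < ‖y‖) (v w : E3) : cylK M 0 hr₀ τ₀ R y v w = kbarRep M r₀ y v w := by
  rw [cylK_apply, cylCutoff_of_le_norm hy.le, cylK₀_zero_spin hr₀ h2M τ₀ R hy, one_mul]

omit [Kerr.Facts] in
/-- The open set `{1 < ‖y‖}`. [folklore] -/
theorem isOpen_one_lt_norm : IsOpen {y : E3 | 1 < ‖y‖} :=
  isOpen_lt continuous_const continuous_norm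

/-- **The zero-spin metric field is a metric pair on `{1 < ‖y‖}`** (restriction of
`isMetricOn_cylH`). [folklore] -/
theorem isMetricOn_cylH_zero_spin (hr₀ : 0 < r₀) (h2M : r₀ < 2 * M) (τ₀ : ℝ)
    (R : E3 →ₗᵢ[ℝ] E3) : IsMetricOn (cylH M 0 r₀ τ₀ R) {y : E3 | 1 < ‖y‖} := by
  obtain ⟨ha, h₁, h₂⟩ := admissible_zero_spin hr₀ h2M
  have h := isMetricOn_cylH ha h₁ h₂ τ₀ R
  exact ⟨isOpen_one_lt_norm, h.contDiffOn.mono (subset_univ _), fun y _ ↦ h.symm y (mem_univ _),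
    fun y _ ↦ h.isInvertible y (mem_univ _)⟩

/-- The zero-spin second fundamental form is smooth. [folklore] -/
theorem contDiff_cylK_zero_spin (hr₀ : 0 < r₀) (h2M : r₀ < 2 * M) (τ₀ : ℝ) (R : E3 →ₗᵢ[ℝ] E3) :
    ContDiff ℝ ∞ (cylK M 0 hr₀ τ₀ R) := by
  obtain ⟨ha, h₁, h₂⟩ := admissible_zero_spin hr₀ h2M
  exact contDiff_cylK ha h₁ h₂ τ₀ R

/-- The zero-spin second fundamental form is symmetric. [folklore] -/
theorem cylK_zero_spin_symm (hr₀ : 0 < r₀) (h2M : r₀ < 2 * M) (τ₀ : ℝ) (R : E3 →ₗᵢ[ℝ] E3)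
    (y v w : E3) : cylK M 0 hr₀ τ₀ R y v w = cylK M 0 hr₀ τ₀ R y w v := by
  obtain ⟨ha, h₁, h₂⟩ := admissible_zero_spin hr₀ h2M
  exact (kerrCylinderDatum ha h₁ h₂ τ₀ R).k_symm y v w

/-- The zero-spin fields solve the momentum constraint on `{1 < ‖y‖}`. [cite: LiMei2020, §4, p. 22] -/
theorem momFn_zero_spin_eq_zero {ι : Type*} [Fintype ι] (b : Basis ι ℝ E3) (hr₀ : 0 < r₀)
    (h2M : r₀ < 2 * M) (τ₀ : ℝ) (R : E3 →ₗᵢ[ℝ] E3) {y : E3} (hy : 1 < ‖y‖) (v : E3) :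
    momFn b (cylH M 0 r₀ τ₀ R) (cylK M 0 hr₀ τ₀ R) y v = 0 := by
  obtain ⟨ha, h₁, h₂⟩ := admissible_zero_spin hr₀ h2M
  exact momFn_cylH_cylK_eq_zero b ha h₁ h₂ τ₀ R hy v

/-- The zero-spin fields solve the Hamiltonian constraint on `{1 < ‖y‖}`. [cite: LiMei2020, §4, p. 22] -/
theorem hamAt_zero_spin_eq_zero (hr₀ : 0 < r₀) (h2M : r₀ < 2 * M) (τ₀ : ℝ) (R : E3 →ₗᵢ[ℝ] E3)
    {y : E3} (hy : 1 < ‖y‖) : hamAt (cylH M 0 r₀ τ₀ R) (cylK M 0 hr₀ τ₀ R) y = 0 := by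
  obtain ⟨ha, h₁, h₂⟩ := admissible_zero_spin hr₀ h2M
  exact hamAt_cylH_cylK_eq_zero ha h₁ h₂ τ₀ R hy

/-! ### The four tangential symmetries are Killing for `G₀` and preserve `K₀` -/

omit [Kerr.Facts] in
/-- `y ↦ y/‖y‖` is smooth off the origin. [folklore] -/
theorem contDiffAt_dirVec {y : E3} (hy : y ≠ 0) {n : WithTop ℕ∞} : ContDiffAt ℝ n dirVec y :=
  ((contDiffAt_norm ℝ hy).inv (norm_ne_zero_iff.2 hy)).smul contDiffAt_id

omit [Kerr.Facts] in
/-- `y ↦ y/‖y‖` is smooth on `{1 < ‖y‖}`. [folklore] -/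
theorem contDiffOn_dirVec {n : WithTop ℕ∞} : ContDiffOn ℝ n dirVec {y : E3 | 1 < ‖y‖} := fun y hy ↦
  (contDiffAt_dirVec (by rintro rfl; norm_num at hy) (n := n)).contDiffWithinAt

omit [Kerr.Facts] in
/-- Points with `1 < ‖y‖` are nonzero. [folklore] -/
theorem ne_zero_of_one_lt_norm {y : E3} (hy : 1 < ‖y‖) : y ≠ 0 := by
  rintro rfl; rw [norm_zero] at hy; exact absurd hy (by norm_num)

omit [Kerr.Facts] in
/-- `{1 < ‖y‖}` is a neighbourhood of each of its points. [folklore] -/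
theorem eventually_one_lt_norm {y : E3} (hy : 1 < ‖y‖) : ∀ᶠ z in 𝓝 y, 1 < ‖z‖ :=
  isOpen_one_lt_norm.mem_nhds hy

/-- **`∂_t` is Killing for `G₀`**: `𝓛_{y/‖y‖} (cylH M 0 r₀ τ₀ R) = 0` on `{1 < ‖y‖}`
(`coordLie₂_gbarRep_dirVec`). [cite: LiMei2020, proof of Prop. 4.1, p. 24] -/
theorem lieFormAt_cylH_zero_spin_dirVec (hr₀ : 0 < r₀) (h2M : r₀ < 2 * M) (τ₀ : ℝ)
    (R : E3 →ₗᵢ[ℝ] E3) {y : E3} (hy : 1 < ‖y‖) : lieFormAt (cylH M 0 r₀ τ₀ R) dirVec y = 0 := by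
  have hG := isMetricOn_cylH_zero_spin hr₀ h2M τ₀ R
  ext v w
  rw [lieFormAt_apply_eq_coordLie₂ (hG.differentiableAt hy),
    coordLie₂_congr v w ((eventually_one_lt_norm hy).mono fun z hz v w ↦
      cylH_zero_spin_apply hr₀ τ₀ R hz.le v w),
    coordLie₂_gbarRep_dirVec M r₀ (ne_zero_of_one_lt_norm hy)]
  rfl

/-- **`∂_t` preserves `K₀`**: `𝓛_{y/‖y‖} (cylK M 0 _ τ₀ R) = 0` on `{1 < ‖y‖}`
(`coordLie₂_kbarRep_dirVec`). [cite: LiMei2020, proof of Prop. 4.1, p. 24] -/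
theorem lieFormAt_cylK_zero_spin_dirVec (hr₀ : 0 < r₀) (h2M : r₀ < 2 * M) (τ₀ : ℝ)
    (R : E3 →ₗᵢ[ℝ] E3) {y : E3} (hy : 1 < ‖y‖) : lieFormAt (cylK M 0 hr₀ τ₀ R) dirVec y = 0 := by
  ext v w
  rw [lieFormAt_apply_eq_coordLie₂ ((contDiff_cylK_zero_spin hr₀ h2M τ₀ R).contDiffAt.differentiableAt
      (by simp)),
    coordLie₂_congr v w ((eventually_one_lt_norm hy).mono fun z hz v w ↦
      cylK_zero_spin_apply hr₀ h2M τ₀ R hz v w),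
    coordLie₂_kbarRep_dirVec M r₀ (ne_zero_of_one_lt_norm hy)]
  rfl

/-- **The rotations are Killing for `G₀`**: `𝓛_{A·} (cylH M 0 r₀ τ₀ R) = 0` on `{1 < ‖y‖}` for
every skew `A` (`coordLie₂_gbarRep_skew`). [cite: LiMei2020, proof of Prop. 4.1, p. 24] -/
theorem lieFormAt_cylH_zero_spin_skew (hr₀ : 0 < r₀) (h2M : r₀ < 2 * M) (τ₀ : ℝ)
    (R : E3 →ₗᵢ[ℝ] E3) (A : E3 →L[ℝ] E3) (hA : ∀ u u' : E3, ⟪A u, u'⟫ = -⟪u, A u'⟫) {y : E3}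
    (hy : 1 < ‖y‖) : lieFormAt (cylH M 0 r₀ τ₀ R) (fun z ↦ A z) y = 0 := by
  have hG := isMetricOn_cylH_zero_spin hr₀ h2M τ₀ R
  ext v w
  rw [lieFormAt_apply_eq_coordLie₂ (hG.differentiableAt hy),
    coordLie₂_congr v w ((eventually_one_lt_norm hy).mono fun z hz v w ↦
      cylH_zero_spin_apply hr₀ τ₀ R hz.le v w),
    coordLie₂_gbarRep_skew M r₀ A hA (ne_zero_of_one_lt_norm hy)]
  rfl

/-- **The rotations preserve `K₀`**: `𝓛_{A·} (cylK M 0 _ τ₀ R) = 0` on `{1 < ‖y‖}` for every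
skew `A` (`coordLie₂_kbarRep_skew`). [cite: LiMei2020, proof of Prop. 4.1, p. 24] -/
theorem lieFormAt_cylK_zero_spin_skew (hr₀ : 0 < r₀) (h2M : r₀ < 2 * M) (τ₀ : ℝ)
    (R : E3 →ₗᵢ[ℝ] E3) (A : E3 →L[ℝ] E3) (hA : ∀ u u' : E3, ⟪A u, u'⟫ = -⟪u, A u'⟫) {y : E3}
    (hy : 1 < ‖y‖) : lieFormAt (cylK M 0 hr₀ τ₀ R) (fun z ↦ A z) y = 0 := by
  ext v w
  rw [lieFormAt_apply_eq_coordLie₂ ((contDiff_cylK_zero_spin hr₀ h2M τ₀ R).contDiffAt.differentiableAt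
      (by simp)),
    coordLie₂_congr v w ((eventually_one_lt_norm hy).mono fun z hz v w ↦
      cylK_zero_spin_apply hr₀ h2M τ₀ R hz v w),
    coordLie₂_kbarRep_skew M r₀ A hA (ne_zero_of_one_lt_norm hy)]
  rfl

/-! ### The four tangential KIDs in operator form -/

variable {ι : Type*} [Fintype ι] (b : Basis ι ℝ E3)

/-- **`(0, ∂_t)` is a KID of the Schwarzschild cylinder data** (operator form): at every point of
`{1 < ‖y‖}` the symmetrised `DM*`-rows of `X = y/‖y‖` vanish,
`adjMomGS G₀ K₀ X y = 0` and `adjMomKS G₀ X y = 0` (Killing + `𝓛_X K₀ = 0` + momentum constraint,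
`IsMetricOn.adjMomS_eq_zero_of_lie_eq_zero`; Moncrief 1975). [cite: LiMei2020, proof of Prop. 4.1, p. 24] -/
theorem adjMomS_cylinder_dirVec_eq_zero (hr₀ : 0 < r₀) (h2M : r₀ < 2 * M) (τ₀ : ℝ)
    (R : E3 →ₗᵢ[ℝ] E3) {y : E3} (hy : 1 < ‖y‖) :
    adjMomGS (cylH M 0 r₀ τ₀ R) (cylK M 0 hr₀ τ₀ R) dirVec y = 0 ∧
      adjMomKS (cylH M 0 r₀ τ₀ R) dirVec y = 0 :=
  (isMetricOn_cylH_zero_spin hr₀ h2M τ₀ R).adjMomS_eq_zero_of_lie_eq_zero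
    (EuclideanSpace.basisFun (Fin 3) ℝ).toBasis hy (contDiff_cylK_zero_spin hr₀ h2M τ₀ R).contDiffOn
    (fun z _ v w ↦ cylK_zero_spin_symm hr₀ h2M τ₀ R z v w) contDiffOn_dirVec
    (lieFormAt_cylH_zero_spin_dirVec hr₀ h2M τ₀ R hy) (lieFormAt_cylK_zero_spin_dirVec hr₀ h2M τ₀ R hy)
    (momFn_zero_spin_eq_zero _ hr₀ h2M τ₀ R hy _)

/-- **`(0, Ω)` is a KID of the Schwarzschild cylinder data** for every skew `A` (operator form):
`adjMomGS G₀ K₀ (A·) y = 0` and `adjMomKS G₀ (A·) y = 0` on `{1 < ‖y‖}`.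
[cite: LiMei2020, proof of Prop. 4.1, p. 24] -/
theorem adjMomS_cylinder_skew_eq_zero (hr₀ : 0 < r₀) (h2M : r₀ < 2 * M) (τ₀ : ℝ)
    (R : E3 →ₗᵢ[ℝ] E3) (A : E3 →L[ℝ] E3) (hA : ∀ u u' : E3, ⟪A u, u'⟫ = -⟪u, A u'⟫) {y : E3}
    (hy : 1 < ‖y‖) :
    adjMomGS (cylH M 0 r₀ τ₀ R) (cylK M 0 hr₀ τ₀ R) (fun z ↦ A z) y = 0 ∧
      adjMomKS (cylH M 0 r₀ τ₀ R) (fun z ↦ A z) y = 0 :=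
  (isMetricOn_cylH_zero_spin hr₀ h2M τ₀ R).adjMomS_eq_zero_of_lie_eq_zero
    (EuclideanSpace.basisFun (Fin 3) ℝ).toBasis hy (contDiff_cylK_zero_spin hr₀ h2M τ₀ R).contDiffOn
    (fun z _ v w ↦ cylK_zero_spin_symm hr₀ h2M τ₀ R z v w) (A.contDiff.contDiffOn)
    (lieFormAt_cylH_zero_spin_skew hr₀ h2M τ₀ R A hA hy)
    (lieFormAt_cylK_zero_spin_skew hr₀ h2M τ₀ R A hA hy) (momFn_zero_spin_eq_zero _ hr₀ h2M τ₀ R hy _)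

/-- **The KID equations for `(N, X) = (0, y/‖y‖)`** at the Schwarzschild cylinder data, both rows
of the full symmetrised adjoint: `DH*_γ 0 + DM*ˢ_γ X = 0` and `DH*_κ 0 + DM*ˢ_κ X = 0` on
`{1 < ‖y‖}`. [cite: LiMei2020, proof of Prop. 4.1, p. 24] -/
theorem kid_cylinder_dirVec (hr₀ : 0 < r₀) (h2M : r₀ < 2 * M) (τ₀ : ℝ) (R : E3 →ₗᵢ[ℝ] E3)
    {y : E3} (hy : 1 < ‖y‖) :
    adjHamG (cylH M 0 r₀ τ₀ R) (cylK M 0 hr₀ τ₀ R) (fun _ ↦ (0 : ℝ)) y +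
        adjMomGS (cylH M 0 r₀ τ₀ R) (cylK M 0 hr₀ τ₀ R) dirVec y = 0 ∧
      adjHamK (cylH M 0 r₀ τ₀ R) (cylK M 0 hr₀ τ₀ R) (fun _ ↦ (0 : ℝ)) y +
        adjMomKS (cylH M 0 r₀ τ₀ R) dirVec y = 0 := by
  obtain ⟨h1, h2⟩ := adjMomS_cylinder_dirVec_eq_zero hr₀ h2M τ₀ R hy
  rw [adjHamG_zero, adjHamK_zero, h1, h2, zero_add]
  exact ⟨rfl, rfl⟩

/-- **The KID equations for `(N, X) = (0, A·)`**, `A` skew, at the Schwarzschild cylinder data.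
[cite: LiMei2020, proof of Prop. 4.1, p. 24] -/
theorem kid_cylinder_skew (hr₀ : 0 < r₀) (h2M : r₀ < 2 * M) (τ₀ : ℝ) (R : E3 →ₗᵢ[ℝ] E3)
    (A : E3 →L[ℝ] E3) (hA : ∀ u u' : E3, ⟪A u, u'⟫ = -⟪u, A u'⟫) {y : E3} (hy : 1 < ‖y‖) :
    adjHamG (cylH M 0 r₀ τ₀ R) (cylK M 0 hr₀ τ₀ R) (fun _ ↦ (0 : ℝ)) y +
        adjMomGS (cylH M 0 r₀ τ₀ R) (cylK M 0 hr₀ τ₀ R) (fun z ↦ A z) y = 0 ∧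
      adjHamK (cylH M 0 r₀ τ₀ R) (cylK M 0 hr₀ τ₀ R) (fun _ ↦ (0 : ℝ)) y +
        adjMomKS (cylH M 0 r₀ τ₀ R) (fun z ↦ A z) y = 0 := by
  obtain ⟨h1, h2⟩ := adjMomS_cylinder_skew_eq_zero hr₀ h2M τ₀ R A hA hy
  rw [adjHamG_zero, adjHamK_zero, h1, h2, zero_add]
  exact ⟨rfl, rfl⟩

/-- **The cokernel identity for `∂_t`**: at the Schwarzschild cylinder data, for all smooth
symmetric variations `(γ, κ)` on `{1 < ‖y‖}`, the pairing of the linearised constraint map with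
the KID `(0, y/‖y‖)` is an exact divergence,
`DM_{(G₀,K₀)}(γ, κ)(y/‖y‖) = div_{G₀}(B_0(γ) + C_X(γ, κ))` (`linConstraint_pairing_eq_divAt_of_kid_sym`
with `N = 0`). Integrated against a compactly supported cut-off this is the projection `𝓘₀` of
Li–Mei (p. 23, `(I_α)`). [cite: LiMei2020, proof of Prop. 4.1, pp. 23–24] -/
theorem linMomFn_cylinder_dirVec_eq_divAt (hr₀ : 0 < r₀) (h2M : r₀ < 2 * M) (τ₀ : ℝ)
    (R : E3 →ₗᵢ[ℝ] E3) {γ κ : E3 → E3 →L[ℝ] E3 →L[ℝ] ℝ}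
    (hγ : ContDiffOn ℝ ∞ γ {y : E3 | 1 < ‖y‖}) (hγs : ∀ y ∈ {y : E3 | 1 < ‖y‖}, ∀ v w, γ y v w = γ y w v)
    (hκ : ContDiffOn ℝ ∞ κ {y : E3 | 1 < ‖y‖}) (hκs : ∀ y ∈ {y : E3 | 1 < ‖y‖}, ∀ v w, κ y v w = κ y w v)
    {y : E3} (hy : 1 < ‖y‖) :
    linMomFn b (cylH M 0 r₀ τ₀ R) (cylK M 0 hr₀ τ₀ R) γ κ y (dirVec y) =
      divAt (cylH M 0 r₀ τ₀ R) (greenVec b (cylH M 0 r₀ τ₀ R) (fun _ ↦ (0 : ℝ)) γ) y +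
        divAt (cylH M 0 r₀ τ₀ R) (momGreenVec (cylH M 0 r₀ τ₀ R) (cylK M 0 hr₀ τ₀ R) γ κ dirVec) y := by
  obtain ⟨hkid₁, hkid₂⟩ := kid_cylinder_dirVec hr₀ h2M τ₀ R hy
  have h := (isMetricOn_cylH_zero_spin hr₀ h2M τ₀ R).linConstraint_pairing_eq_divAt_of_kid_sym b hy
    (contDiff_cylK_zero_spin hr₀ h2M τ₀ R).contDiffOn (fun z _ v w ↦ cylK_zero_spin_symm hr₀ h2M τ₀ R z v w)
    hγ hγs hκ hκs (N := fun _ ↦ (0 : ℝ)) contDiffOn_const contDiffOn_dirVec hkid₁ hkid₂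
  rwa [zero_mul, zero_add] at h

/-- **The cokernel identity for the rotations**: for every skew `A` and all smooth symmetric
variations `(γ, κ)` on `{1 < ‖y‖}`,
`DM_{(G₀,K₀)}(γ, κ)(A y) = div_{G₀}(B_0(γ) + C_{A·}(γ, κ))` — the projections `𝓘₁, 𝓘₂, 𝓘₃` of
Li–Mei (p. 23, `(I_α)`). [cite: LiMei2020, proof of Prop. 4.1, pp. 23–24] -/
theorem linMomFn_cylinder_skew_eq_divAt (hr₀ : 0 < r₀) (h2M : r₀ < 2 * M) (τ₀ : ℝ)
    (R : E3 →ₗᵢ[ℝ] E3) (A : E3 →L[ℝ] E3) (hA : ∀ u u' : E3, ⟪A u, u'⟫ = -⟪u, A u'⟫)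
    {γ κ : E3 → E3 →L[ℝ] E3 →L[ℝ] ℝ}
    (hγ : ContDiffOn ℝ ∞ γ {y : E3 | 1 < ‖y‖}) (hγs : ∀ y ∈ {y : E3 | 1 < ‖y‖}, ∀ v w, γ y v w = γ y w v)
    (hκ : ContDiffOn ℝ ∞ κ {y : E3 | 1 < ‖y‖}) (hκs : ∀ y ∈ {y : E3 | 1 < ‖y‖}, ∀ v w, κ y v w = κ y w v)
    {y : E3} (hy : 1 < ‖y‖) :
    linMomFn b (cylH M 0 r₀ τ₀ R) (cylK M 0 hr₀ τ₀ R) γ κ y (A y) =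
      divAt (cylH M 0 r₀ τ₀ R) (greenVec b (cylH M 0 r₀ τ₀ R) (fun _ ↦ (0 : ℝ)) γ) y +
        divAt (cylH M 0 r₀ τ₀ R)
          (momGreenVec (cylH M 0 r₀ τ₀ R) (cylK M 0 hr₀ τ₀ R) γ κ (fun z ↦ A z)) y := by
  obtain ⟨hkid₁, hkid₂⟩ := kid_cylinder_skew hr₀ h2M τ₀ R A hA hy
  have h := (isMetricOn_cylH_zero_spin hr₀ h2M τ₀ R).linConstraint_pairing_eq_divAt_of_kid_sym b hy
    (contDiff_cylK_zero_spin hr₀ h2M τ₀ R).contDiffOn (fun z _ v w ↦ cylK_zero_spin_symm hr₀ h2M τ₀ R z v w)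
    hγ hγs hκ hκs (N := fun _ ↦ (0 : ℝ)) contDiffOn_const (A.contDiff.contDiffOn) hkid₁ hkid₂
  rwa [zero_mul, zero_add] at h

end ZeroSpin

end LiMei

end Literature.Geometry.Lorentzian

end
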